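import Mathlib

/-!
# Planes in the determinant cone of the pencil (`F5` of the blueprint)
# (crux `RankRigidMinimalRepr`, stmt-ValiantsHypothesis-18034, route `RigidityForcesSymmetry`)

The determinant of the pencil `M(t)_{ij} = (Σt) - t_i - t_j` (`i ≠ j`, zero diagonal) is `4·F(t)` with
`F(t) = 4e₄(t) - e₁(t)e₃(t)`.  THEOREM (`pencil_planes`): a `2`-plane `span(p,q) ⊆ {F = 0}` contains (hence
equals) one of the sixteen planes
* `span(e_c, e_d)`                                  (type III, «BLOCK»),
* `span(e_a + e_b, e_c - e_d)`, `{a,b,c,d}` all distinct (type II, «EA»),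
* `span(e_b - e_d, e_c - e_d) = {t_a = 0, Σt = 0}`  (type I, «star»).
Proof: if `e₁ ≡ 0` on the plane, `e₄ ≡ 0` and a coordinate vanishes identically (pigeonhole): type I.  Else the plane is
`{s r + q}`, `e₁(r) = 0`, `e₁(q) = 1`; the coefficients in `s` give `r_a = 0` and then types II/III or a contradiction.
HONEST FRAMING: a lemma about `4 × 4` matrices toward `LaplaceOptimal 4`; the crux stays OPEN; nothing on `VP ≠ VNP`.
-/

set_option autoImplicit false

-- the mandated summit-side namespace repeats a component by design (single-problem summit)
set_option linter.dupNamespace false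

namespace Summit.ValiantsHypothesis.ValiantsHypothesis.Theorems.RigidityForcesSymmetryRankRigidMinimalRepr

namespace LaplaceFourLine

/-! ### §1 The quartic form -/

/-- The quartic `F(t) = 4e₄(t) - e₁(t)e₃(t)` (`det M(t) = 4F(t)` for the pencil `M(t)`; it is passed around as a function
`F` with its defining equation `hFdef`) is symmetric: the same expression in any ordering of the coordinates. -/
theorem detForm_eq (F : (Fin 4 → ℂ) → ℂ) (hFdef : ∀ t, F t = 4 * (t 0 * t 1 * t 2 * t 3) -
      (t 0 + t 1 + t 2 + t 3) * (t 1 * t 2 * t 3 + t 0 * t 2 * t 3 + t 0 * t 1 * t 3 + t 0 * t 1 * t 2))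
    (t : Fin 4 → ℂ) (a b c d : Fin 4) (h : [a, b, c, d].Nodup) :
    F t = 4 * (t a * t b * t c * t d) -
      (t a + t b + t c + t d) * (t b * t c * t d + t a * t c * t d + t a * t b * t d + t a * t b * t c) := by
  rw [hFdef]
  fin_cases a <;> fin_cases b <;> fin_cases c <;> fin_cases d <;> simp at h ⊢ <;> ring

/-- The coordinate sum in any ordering of the coordinates. -/
theorem sum_four_eq (t : Fin 4 → ℂ) (a b c d : Fin 4) (h : [a, b, c, d].Nodup) :
    t a + t b + t c + t d = t 0 + t 1 + t 2 + t 3 := by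
  fin_cases a <;> fin_cases b <;> fin_cases c <;> fin_cases d <;> simp at h ⊢ <;> ring

/-! ### §2 Type I: `e₁ ≡ 0` on the plane -/

/-- If `e₁` vanishes on the plane then some coordinate vanishes on it. -/
theorem planes_case1 (F : (Fin 4 → ℂ) → ℂ) (hFdef : ∀ t, F t = 4 * (t 0 * t 1 * t 2 * t 3) -
      (t 0 + t 1 + t 2 + t 3) * (t 1 * t 2 * t 3 + t 0 * t 2 * t 3 + t 0 * t 1 * t 3 + t 0 * t 1 * t 2))
    (p q : Fin 4 → ℂ) (hp : p 0 + p 1 + p 2 + p 3 = 0) (hq : q 0 + q 1 + q 2 + q 3 = 0)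
    (hF : ∀ s : ℂ, F (s • p + q) = 0) : ∃ i, p i = 0 ∧ q i = 0 := by
  have he4 : ∀ s : ℂ, ∏ i, (s * p i + q i) = 0 := by
    intro s
    have h := hF s
    simp only [hFdef, Pi.add_apply, Pi.smul_apply, smul_eq_mul] at h
    rw [Fin.prod_univ_four]
    linear_combination h / 4 +
      (s * p 1 + q 1) * (s * p 2 + q 2) * (s * p 3 + q 3) * (s * hp + hq) / 4 +
      (s * p 0 + q 0) * (s * p 2 + q 2) * (s * p 3 + q 3) * (s * hp + hq) / 4 +
      (s * p 0 + q 0) * (s * p 1 + q 1) * (s * p 3 + q 3) * (s * hp + hq) / 4 +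
      (s * p 0 + q 0) * (s * p 1 + q 1) * (s * p 2 + q 2) * (s * hp + hq) / 4
  by_contra hne
  push Not at hne
  have hroot : ∀ s : Fin 5, ∃ i : Fin 4, ((s : ℕ) : ℂ) * p i + q i = 0 := by
    intro s
    simpa [Finset.prod_eq_zero_iff] using he4 s
  choose f hf using hroot
  obtain ⟨s, s', hne', hff⟩ := Fintype.exists_ne_map_eq_of_card_lt f (by simp)
  have h1 := hf s
  have h2 := hf s'
  rw [hff] at h1
  have hp0 : p (f s') = 0 := by
    have : (((s : ℕ) : ℂ) - s') * p (f s') = 0 := by linear_combination h1 - h2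
    rcases mul_eq_zero.1 this with h | h
    · exfalso; apply hne'
      have : ((s : ℕ) : ℂ) = s' := by linear_combination h
      exact Fin.ext (by exact_mod_cast this)
    · exact h
  exact hne (f s') hp0 (by rw [hp0, mul_zero, zero_add] at h2; exact h2)

/-! ### §3 The two cores of the case `e₁ ≢ 0` -/

/-- Core 2b: `r = ρ(e_c - e_d)`.  Then `q_a = q_b = ½, q_d = -q_c` (type II) or `q_a = q_b = 0` (type III). -/
theorem planes_core2b (a b c d : Fin 4) (r q : Fin 4 → ℂ) (hra : r a = 0) (hrb : r b = 0) (hrc : r c ≠ 0)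
    (hSr : r a + r b + r c + r d = 0) (hSq : q a + q b + q c + q d = 1)
    (hF : ∀ s : ℂ, 4 * ((s * r a + q a) * (s * r b + q b) * (s * r c + q c) * (s * r d + q d)) -
      ((s * r a + q a) + (s * r b + q b) + (s * r c + q c) + (s * r d + q d)) *
        ((s * r b + q b) * (s * r c + q c) * (s * r d + q d) + (s * r a + q a) * (s * r c + q c) * (s * r d + q d) +
          (s * r a + q a) * (s * r b + q b) * (s * r d + q d) + (s * r a + q a) * (s * r b + q b) * (s * r c + q c)) = 0) :
    (q a = 1 / 2 ∧ q b = 1 / 2 ∧ q c + q d = 0) ∨ (q a = 0 ∧ q b = 0 ∧ q c + q d = 1) := by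
  obtain ⟨ρ, hρ⟩ : ∃ ρ, r c = ρ := ⟨_, rfl⟩
  have hrd : r d = -ρ := by linear_combination hSr - hra - hrb - hρ
  have key : ∀ s : ℂ, (4 * (q a * q b) - (q a + q b)) * ((q c + s * ρ) * (q d - s * ρ)) -
      q a * q b * (q c + q d) = 0 := by
    intro s
    have h := hF s
    rw [hra, hrb, hρ, hrd] at h
    linear_combination h + ((q a + q b) * ((q c + s * ρ) * (q d - s * ρ)) + q a * q b * (q c + q d)) * hSq
  have hρ0 : ρ ≠ 0 := hρ ▸ hrc
  -- `s²`: `4 q_a q_b = q_a + q_b`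
  have h2 : 4 * (q a * q b) - (q a + q b) = 0 := by
    have : (4 * (q a * q b) - (q a + q b)) * ρ ^ 2 = 0 := by
      linear_combination (-(key 1) - key (-1) + 2 * key 0) / 2
    exact (mul_eq_zero.1 this).resolve_right (pow_ne_zero 2 hρ0)
  -- `s⁰`: `q_a q_b (q_c + q_d) = 0`
  have h0 : q a * q b * (q c + q d) = 0 := by linear_combination -(key 0) + (q c * q d) * h2
  rcases mul_eq_zero.1 h0 with hpa | hB
  · right
    have hA : q a + q b = 0 := by linear_combination 4 * hpa - h2
    rcases mul_eq_zero.1 hpa with h | h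
    · exact ⟨h, by linear_combination hA - h, by linear_combination hSq - hA⟩
    · exact ⟨by linear_combination hA - h, h, by linear_combination hSq - hA⟩
  · left
    have hA : q a + q b = 1 := by linear_combination hSq - hB
    have hsq : (q a - q b) ^ 2 = 0 := by linear_combination (q a + q b) * hA - h2
    have hab : q a - q b = 0 := pow_eq_zero_iff two_ne_zero |>.1 hsq
    exact ⟨by linear_combination (hA + hab) / 2, by linear_combination (hA - hab) / 2, hB⟩

/-- Core 2a: `r_a = 0` and `r_b r_c r_d ≠ 0` is impossible. -/
theorem planes_core2a (a b c d : Fin 4) (r q : Fin 4 → ℂ) (hra : r a = 0) (hrb : r b ≠ 0) (hrc : r c ≠ 0)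
    (hrd : r d ≠ 0) (hSr : r a + r b + r c + r d = 0) (hSq : q a + q b + q c + q d = 1)
    (hF : ∀ s : ℂ, 4 * ((s * r a + q a) * (s * r b + q b) * (s * r c + q c) * (s * r d + q d)) -
      ((s * r a + q a) + (s * r b + q b) + (s * r c + q c) + (s * r d + q d)) *
        ((s * r b + q b) * (s * r c + q c) * (s * r d + q d) + (s * r a + q a) * (s * r c + q c) * (s * r d + q d) +
          (s * r a + q a) * (s * r b + q b) * (s * r d + q d) + (s * r a + q a) * (s * r b + q b) * (s * r c + q c)) = 0) :
    False := by
  obtain ⟨⟨B, hB⟩, ⟨C, hC⟩⟩ : (∃ x, r b = x) ∧ (∃ x, r c = x) := ⟨⟨_, rfl⟩, ⟨_, rfl⟩⟩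
  have hD : r d = -B - C := by linear_combination hSr - hra - hB - hC
  have hB0 : B ≠ 0 := hB ▸ hrb
  have hC0 : C ≠ 0 := hC ▸ hrc
  have hD0 : -B - C ≠ 0 := hD ▸ hrd
  -- the polynomial `4E₄ - E₃` in `s` (using `e₁ = 1`)
  have key : ∀ s : ℂ, 4 * (q a * (s * B + q b) * (s * C + q c) * (s * (-B - C) + q d)) -
      ((s * B + q b) * (s * C + q c) * (s * (-B - C) + q d) + q a * ((s * C + q c) * (s * (-B - C) + q d) +
        (s * B + q b) * (s * (-B - C) + q d) + (s * B + q b) * (s * C + q c))) = 0 := by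
    intro s
    have h := hF s
    rw [hra, hB, hC, hD] at h
    linear_combination h + ((s * B + q b) * (s * C + q c) * (s * (-B - C) + q d) +
      q a * ((s * C + q c) * (s * (-B - C) + q d) + (s * B + q b) * (s * (-B - C) + q d) +
        (s * B + q b) * (s * C + q c))) * hSq
  have k0 := key 0; have k1 := key 1; have km1 := key (-1); have k2 := key 2; have km2 := key (-2)
  -- `s³`: `q_a = 1/4`
  have c3 : (4 * q a - 1) * (B * C * (-B - C)) = 0 := by
    linear_combination (k2 - 2 * k1 + 2 * km1 - km2) / 12
  have hqa : 4 * q a - 1 = 0 :=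
    (mul_eq_zero.1 c3).resolve_right (mul_ne_zero (mul_ne_zero hB0 hC0) hD0)
  -- `s²`: `e₂(r') = 0`
  have c2raw : (4 * q a - 1) * (B * C * q d + B * (-B - C) * q c + C * (-B - C) * q b) -
      q a * (C * (-B - C) + B * (-B - C) + B * C) = 0 := by
    linear_combination (-k2 + 16 * k1 - 30 * k0 + 16 * km1 - km2) / 24
  have c2 : B ^ 2 + B * C + C ^ 2 = 0 := by
    linear_combination 4 * c2raw - (4 * (B * C * q d + B * (-B - C) * q c + C * (-B - C) * q b) -
      (C * (-B - C) + B * (-B - C) + B * C)) * hqa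
  -- `s¹`: `⟨r,q⟩ = 0`
  have c1raw : (4 * q a - 1) * (B * q c * q d + C * q b * q d + (-B - C) * q b * q c) -
      q a * (C * q d + (-B - C) * q c + B * q d + (-B - C) * q b + B * q c + C * q b) = 0 := by
    linear_combination (8 * (k1 - km1) - (k2 - km2)) / 12
  have c1 : B * q b + C * q c + (-B - C) * q d = 0 := by
    linear_combination 4 * c1raw - (4 * (B * q c * q d + C * q b * q d + (-B - C) * q b * q c) -
      (C * q d + (-B - C) * q c + B * q d + (-B - C) * q b + B * q c + C * q b)) * hqa
  -- `s⁰`: `e₂(q') = 0`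
  have c0 : q c * q d + q b * q d + q b * q c = 0 := by
    linear_combination -4 * k0 + (4 * (q b * q c * q d) - (q c * q d + q b * q d + q b * q c)) * hqa
  -- `x = q' - ¼𝟙` is orthogonal to `𝟙` and to `r'`, hence parallel to `r'`, hence `e₂(x) = 0`; but `e₂(q') = 3/16`
  have hx : (q b - 1 / 4) + (q c - 1 / 4) + (q d - 1 / 4) = 0 := by linear_combination hSq - hqa / 4
  have hE : (q b - 1 / 4) * (2 * B + C) + (q c - 1 / 4) * (B + 2 * C) = 0 := by
    linear_combination c1 + (B + C) * hx
  have hBC : B + 2 * C ≠ 0 := by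
    intro h0
    have : 3 * C ^ 2 = 0 := by linear_combination c2 - (B - C) * h0
    exact hC0 (pow_eq_zero_iff two_ne_zero |>.1 ((mul_eq_zero.1 this).resolve_left three_ne_zero))
  have hDm : (q b - 1 / 4) * C - (q c - 1 / 4) * B = 0 := by
    have : ((q b - 1 / 4) * C - (q c - 1 / 4) * B) * (B + 2 * C) = 0 := by
      linear_combination -B * hE + 2 * (q b - 1 / 4) * c2
    exact (mul_eq_zero.1 this).resolve_right hBC
  have he2x : (q c - 1 / 4) * (q d - 1 / 4) + (q b - 1 / 4) * (q d - 1 / 4) + (q b - 1 / 4) * (q c - 1 / 4) = 0 := by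
    have : B ^ 2 * ((q c - 1 / 4) * (q d - 1 / 4) + (q b - 1 / 4) * (q d - 1 / 4) +
        (q b - 1 / 4) * (q c - 1 / 4)) = 0 := by
      linear_combination B ^ 2 * ((q b - 1 / 4) + (q c - 1 / 4)) * hx - (q b - 1 / 4) ^ 2 * c2 +
        (B * (q c - 1 / 4) + B * (q b - 1 / 4) + C * (q b - 1 / 4)) * hDm
    exact (mul_eq_zero.1 this).resolve_left (pow_ne_zero 2 hB0)
  have : (3 : ℂ) / 16 = 0 := by
    linear_combination c0 - he2x - (1 / 2) * hx
  norm_num at this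
/-! ### §4 Assembly of the classification -/

/-- A vector identity on `Fin 4` from its four coordinates (in a given labelling). -/
theorem veq {a b c d : Fin 4} (hall : ∀ i : Fin 4, i = a ∨ i = b ∨ i = c ∨ i = d) (x y : Fin 4 → ℂ)
    (ha : x a = y a) (hb : x b = y b) (hc : x c = y c) (hd : x d = y d) : x = y := by
  funext i; rcases hall i with rfl | rfl | rfl | rfl <;> assumption

/-- Case 2 (`e₁ ≢ 0`) with the zero coordinate of `r` at `a`: the plane `{s r + q}` is of type II or III. -/
theorem planes_case2 (F : (Fin 4 → ℂ) → ℂ) (hFdef : ∀ t, F t = 4 * (t 0 * t 1 * t 2 * t 3) -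
      (t 0 + t 1 + t 2 + t 3) * (t 1 * t 2 * t 3 + t 0 * t 2 * t 3 + t 0 * t 1 * t 3 + t 0 * t 1 * t 2))
    (a b c d : Fin 4) (hnd : [a, b, c, d].Nodup) (hall : ∀ i : Fin 4, i = a ∨ i = b ∨ i = c ∨ i = d)
    (r q : Fin 4 → ℂ) (hra : r a = 0) (hr0 : ¬(r b = 0 ∧ r c = 0 ∧ r d = 0))
    (hSr : r a + r b + r c + r d = 0) (hSq : q a + q b + q c + q d = 1)
    (hF : ∀ s : ℂ, F (s • r + q) = 0) :
    ∃ x y : Fin 4 → ℂ, (∃ α β : ℂ, x = α • r + β • q) ∧ (∃ α β : ℂ, y = α • r + β • q) ∧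
      ((∃ c' d' : Fin 4, c' ≠ d' ∧ x = Pi.single c' 1 ∧ y = Pi.single d' 1) ∨
       (∃ a' b' c' d' : Fin 4, [a', b', c', d'].Nodup ∧ x = Pi.single a' 1 + Pi.single b' 1 ∧
          y = Pi.single c' 1 - Pi.single d' 1)) := by
  have h' := hnd
  simp only [List.nodup_cons, List.mem_cons, not_or, List.not_mem_nil, List.nodup_nil, not_false_eq_true,
    and_true] at h'
  obtain ⟨⟨hab, hac, had⟩, ⟨hbc, hbd⟩, hcd⟩ := h'
  have hF' : ∀ s : ℂ, 4 * ((s * r a + q a) * (s * r b + q b) * (s * r c + q c) * (s * r d + q d)) -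
      ((s * r a + q a) + (s * r b + q b) + (s * r c + q c) + (s * r d + q d)) *
        ((s * r b + q b) * (s * r c + q c) * (s * r d + q d) + (s * r a + q a) * (s * r c + q c) * (s * r d + q d) +
          (s * r a + q a) * (s * r b + q b) * (s * r d + q d) + (s * r a + q a) * (s * r b + q b) * (s * r c + q c)) =
      0 := by
    intro s
    have h := hF s
    rw [detForm_eq F hFdef _ a b c d hnd] at h
    simpa only [Pi.add_apply, Pi.smul_apply, smul_eq_mul] using h
  -- the generic sub-case handler for two zeros at `a` and `b'`
  have two : ∀ b' c' d' : Fin 4, [a, b', c', d'].Nodup → (∀ i : Fin 4, i = a ∨ i = b' ∨ i = c' ∨ i = d') →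
      r b' = 0 → r c' ≠ 0 →
      ∃ x y : Fin 4 → ℂ, (∃ α β : ℂ, x = α • r + β • q) ∧ (∃ α β : ℂ, y = α • r + β • q) ∧
        ((∃ c' d' : Fin 4, c' ≠ d' ∧ x = Pi.single c' 1 ∧ y = Pi.single d' 1) ∨
         (∃ a' b' c' d' : Fin 4, [a', b', c', d'].Nodup ∧ x = Pi.single a' 1 + Pi.single b' 1 ∧
            y = Pi.single c' 1 - Pi.single d' 1)) := by
    intro b' c' d' hnd' hall' hrb' hrc'
    have h' := hnd'
    simp only [List.nodup_cons, List.mem_cons, not_or, List.not_mem_nil, List.nodup_nil, not_false_eq_true,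
    and_true] at h'
    obtain ⟨⟨hab', hac', had'⟩, ⟨hbc', hbd'⟩, hcd'⟩ := h'
    have hSr' : r a + r b' + r c' + r d' = 0 := by
      rw [sum_four_eq r a b' c' d' hnd', ← sum_four_eq r a b c d hnd]; exact hSr
    have hSq' : q a + q b' + q c' + q d' = 1 := by
      rw [sum_four_eq q a b' c' d' hnd', ← sum_four_eq q a b c d hnd]; exact hSq
    have hF'' : ∀ s : ℂ, 4 * ((s * r a + q a) * (s * r b' + q b') * (s * r c' + q c') * (s * r d' + q d')) -
        ((s * r a + q a) + (s * r b' + q b') + (s * r c' + q c') + (s * r d' + q d')) *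
          ((s * r b' + q b') * (s * r c' + q c') * (s * r d' + q d') +
            (s * r a + q a) * (s * r c' + q c') * (s * r d' + q d') +
            (s * r a + q a) * (s * r b' + q b') * (s * r d' + q d') +
            (s * r a + q a) * (s * r b' + q b') * (s * r c' + q c')) = 0 := by
      intro s
      have h := hF s
      rw [detForm_eq F hFdef _ a b' c' d' hnd'] at h
      simpa only [Pi.add_apply, Pi.smul_apply, smul_eq_mul] using h
    have hrd' : r d' = -r c' := by linear_combination hSr' - hra - hrb'
    rcases planes_core2b a b' c' d' r q hra hrb' hrc' hSr' hSq' hF'' with ⟨hqa, hqb, hqcd⟩ | ⟨hqa, hqb, hqcd⟩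
    · -- type II (a b' | c' d')
      refine ⟨Pi.single a 1 + Pi.single b' 1, Pi.single c' 1 - Pi.single d' 1,
        ⟨-(2 * q c' / r c'), 2, veq hall' _ _ ?_ ?_ ?_ ?_⟩, ⟨1 / r c', 0, veq hall' _ _ ?_ ?_ ?_ ?_⟩,
        Or.inr ⟨a, b', c', d', hnd', rfl, rfl⟩⟩
      · simp [hab']; rw [hra, hqa]; norm_num
      · simp [(Ne.symm hab')]; rw [hrb', hqb]; norm_num
      · simp [(Ne.symm hac'), (Ne.symm hbc')]; field_simp; ring
      · simp [(Ne.symm had'), (Ne.symm hbd')]; rw [hrd']; field_simp; linear_combination -2 * hqcd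
      · simp [hac', had']; rw [hra]; simp
      · simp [hbc', hbd']; rw [hrb']; simp
      · simp [hcd']; field_simp
      · simp [(Ne.symm hcd')]; rw [hrd']; field_simp
    · -- type III (c' d')
      refine ⟨Pi.single c' 1, Pi.single d' 1, ⟨q d' / r c', 1, veq hall' _ _ ?_ ?_ ?_ ?_⟩,
        ⟨-(q c' / r c'), 1, veq hall' _ _ ?_ ?_ ?_ ?_⟩, Or.inl ⟨c', d', hcd', rfl, rfl⟩⟩
      · simp [hac']; rw [hra, hqa]; simp
      · simp [hbc']; rw [hrb', hqb]; simp
      · simp; field_simp; linear_combination -hqcd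
      · simp [hcd']; rw [hrd']; field_simp; ring
      · simp [had']; rw [hra, hqa]; simp
      · simp [hbd']; rw [hrb', hqb]; simp
      · simp [(Ne.symm hcd')]; field_simp; ring
      · simp; rw [hrd']; field_simp; linear_combination -hqcd
  by_cases hb : r b = 0
  · exact two b c d hnd hall hb (fun hc => hr0 ⟨hb, hc, by linear_combination hSr - hra - hb - hc⟩)
  by_cases hc : r c = 0
  · have hnd' : [a, c, b, d].Nodup := by simp [hab, hac, had, hbd, hcd, Ne.symm hbc]
    exact two c b d hnd' (fun i => by rcases hall i with h | h | h | h <;> simp [h]) hc hb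
  by_cases hd : r d = 0
  · have hnd' : [a, d, b, c].Nodup := by simp [hab, hac, had, hbc, Ne.symm hbd, Ne.symm hcd]
    exact two d b c hnd' (fun i => by rcases hall i with h | h | h | h <;> simp [h]) hd hb
  exact (planes_core2a a b c d r q hra hb hc hd hSr hSq hF').elim

/-- **Planes in the determinant cone** (`F5`).  If `p, q` are linearly independent and `F` vanishes on
`span(p,q)`, then the plane contains the basis of a plane of type III, II or I (listed in the module docstring). -/
theorem pencil_planes (F : (Fin 4 → ℂ) → ℂ) (hFdef : ∀ t, F t = 4 * (t 0 * t 1 * t 2 * t 3) -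
      (t 0 + t 1 + t 2 + t 3) * (t 1 * t 2 * t 3 + t 0 * t 2 * t 3 + t 0 * t 1 * t 3 + t 0 * t 1 * t 2))
    (p q : Fin 4 → ℂ) (hind : ∀ α β : ℂ, α • p + β • q = 0 → α = 0 ∧ β = 0)
    (hF : ∀ s u : ℂ, F (s • p + u • q) = 0) :
    ∃ x y : Fin 4 → ℂ, (∃ α β : ℂ, x = α • p + β • q) ∧ (∃ α β : ℂ, y = α • p + β • q) ∧
      ((∃ c d : Fin 4, c ≠ d ∧ x = Pi.single c 1 ∧ y = Pi.single d 1) ∨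
       (∃ a b c d : Fin 4, [a, b, c, d].Nodup ∧ x = Pi.single a 1 + Pi.single b 1 ∧
          y = Pi.single c 1 - Pi.single d 1) ∨
       (∃ a b c d : Fin 4, [a, b, c, d].Nodup ∧ x = Pi.single b 1 - Pi.single d 1 ∧
          y = Pi.single c 1 - Pi.single d 1)) := by
  have hp0 : p ≠ 0 := fun h => one_ne_zero (hind 1 0 (by simp [h])).1
  by_cases h1 : p 0 + p 1 + p 2 + p 3 = 0 ∧ q 0 + q 1 + q 2 + q 3 = 0
  · -- type I
    obtain ⟨i, hpi, hqi⟩ := planes_case1 F hFdef p q h1.1 h1.2 (fun s => by simpa using hF s 1)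
    -- the three other indices
    obtain ⟨j, k, l, hnd, hall⟩ : ∃ j k l : Fin 4, [i, j, k, l].Nodup ∧ ∀ m : Fin 4, m = i ∨ m = j ∨ m = k ∨ m = l := by
      fin_cases i
      · exact ⟨1, 2, 3, by decide, by decide⟩
      · exact ⟨0, 2, 3, by decide, by decide⟩
      · exact ⟨0, 1, 3, by decide, by decide⟩
      · exact ⟨0, 1, 2, by decide, by decide⟩
    have h' := hnd
    simp only [List.nodup_cons, List.mem_cons, not_or, List.not_mem_nil, List.nodup_nil, not_false_eq_true,
    and_true] at h'
    obtain ⟨⟨hij, hik, hil⟩, ⟨hjk, hjl⟩, hkl⟩ := h'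
    have hpl : p l = -p j - p k := by
      have := sum_four_eq p i j k l hnd; rw [hpi] at this; linear_combination this + h1.1
    have hql : q l = -q j - q k := by
      have := sum_four_eq q i j k l hnd; rw [hqi] at this; linear_combination this + h1.2
    -- the `2 × 2` minor
    obtain ⟨Δ, hΔdef⟩ : ∃ Δ, p j * q k - p k * q j = Δ := ⟨_, rfl⟩
    have hΔ : Δ ≠ 0 := by
      intro hΔ
      rw [hΔ] at hΔdef
      have h2 := hind (q k) (-p k) (veq hall _ _ (by simp [hpi, hqi]) (by simp; linear_combination hΔdef)
        (by simp; ring) (by simp [hpl, hql]; linear_combination -hΔdef))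
      have h3 := hind (q j) (-p j) (veq hall _ _ (by simp [hpi, hqi]) (by simp; ring)
        (by simp; linear_combination -hΔdef) (by simp [hpl, hql]; linear_combination hΔdef))
      apply hp0
      exact veq hall _ _ (by simp [hpi]) (by simp; linear_combination -h3.2)
        (by simp; linear_combination -h2.2) (by simp [hpl]; linear_combination h3.2 + h2.2)
    refine ⟨Pi.single j 1 - Pi.single l 1, Pi.single k 1 - Pi.single l 1,
      ⟨q k / Δ, -(p k / Δ), veq hall _ _ ?_ ?_ ?_ ?_⟩, ⟨-(q j / Δ), p j / Δ, veq hall _ _ ?_ ?_ ?_ ?_⟩,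
      Or.inr (Or.inr ⟨i, j, k, l, hnd, rfl, rfl⟩)⟩
    · simp [(Ne.symm hij), (Ne.symm hil), hpi, hqi]
    · simp [hjl]; field_simp; linear_combination -hΔdef
    · simp [(Ne.symm hjk), hkl]; field_simp; ring
    · simp [(Ne.symm hjl), hpl, hql]; field_simp; linear_combination hΔdef
    · simp [(Ne.symm hik), (Ne.symm hil), hpi, hqi]
    · simp [hjk, hjl]; field_simp; ring
    · simp [hkl]; field_simp; linear_combination -hΔdef
    · simp [(Ne.symm hkl), hpl, hql]; field_simp; linear_combination hΔdef
  · -- case 2: `e₁ ≢ 0`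
    obtain ⟨⟨Sp, hSp⟩, ⟨Sq, hSq⟩⟩ : (∃ x, p 0 + p 1 + p 2 + p 3 = x) ∧ (∃ x, q 0 + q 1 + q 2 + q 3 = x) := ⟨⟨_, rfl⟩, ⟨_, rfl⟩⟩
    rw [hSp, hSq] at h1
    -- `r` with `e₁(r) = 0` and `q'` with `e₁(q') = 1`, both in the plane
    obtain ⟨r, hr⟩ : ∃ r : Fin 4 → ℂ, r = Sq • p - Sp • q := ⟨_, rfl⟩
    obtain ⟨c₁, c₂, hc⟩ : ∃ c₁ c₂ : ℂ, c₁ * Sp + c₂ * Sq = 1 := by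
      by_cases hp : Sp = 0
      · have hq : Sq ≠ 0 := fun hq => h1 ⟨hp, hq⟩
        exact ⟨0, Sq⁻¹, by rw [zero_mul, zero_add, inv_mul_cancel₀ hq]⟩
      · exact ⟨Sp⁻¹, 0, by rw [zero_mul, add_zero, inv_mul_cancel₀ hp]⟩
    obtain ⟨q', hq'⟩ : ∃ q' : Fin 4 → ℂ, q' = c₁ • p + c₂ • q := ⟨_, rfl⟩
    have hSr : r 0 + r 1 + r 2 + r 3 = 0 := by
      simp only [hr, Pi.sub_apply, Pi.smul_apply, smul_eq_mul]; linear_combination Sq * hSp - Sp * hSq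
    have hSq' : q' 0 + q' 1 + q' 2 + q' 3 = 1 := by
      simp only [hq', Pi.add_apply, Pi.smul_apply, smul_eq_mul]; linear_combination c₁ * hSp + c₂ * hSq + hc
    have hF' : ∀ s : ℂ, F (s • r + q') = 0 := by
      intro s
      have := hF (s * Sq + c₁) (-(s * Sp) + c₂)
      rw [show s • r + q' = (s * Sq + c₁) • p + (-(s * Sp) + c₂) • q by
        rw [hr, hq']; funext i; simp; ring]
      exact this
    have hspan : ∀ x : Fin 4 → ℂ, (∃ α β : ℂ, x = α • r + β • q') → ∃ α β : ℂ, x = α • p + β • q := by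
      rintro x ⟨α, β, rfl⟩
      exact ⟨α * Sq + β * c₁, -(α * Sp) + β * c₂, by rw [hr, hq']; funext i; simp; ring⟩
    have hr0 : r ≠ 0 := by
      intro h0
      rw [hr, show Sq • p - Sp • q = Sq • p + (-Sp) • q by rw [sub_eq_add_neg, neg_smul]] at h0
      have := hind Sq (-Sp) h0
      exact h1 ⟨by linear_combination -this.2, this.1⟩
    -- the `s⁴` coefficient: a coordinate of `r` vanishes
    have key : ∀ s : ℂ, 4 * ((s * r 0 + q' 0) * (s * r 1 + q' 1) * (s * r 2 + q' 2) * (s * r 3 + q' 3)) -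
        ((s * r 0 + q' 0) + (s * r 1 + q' 1) + (s * r 2 + q' 2) + (s * r 3 + q' 3)) *
          ((s * r 1 + q' 1) * (s * r 2 + q' 2) * (s * r 3 + q' 3) + (s * r 0 + q' 0) * (s * r 2 + q' 2) * (s * r 3 + q' 3) +
            (s * r 0 + q' 0) * (s * r 1 + q' 1) * (s * r 3 + q' 3) + (s * r 0 + q' 0) * (s * r 1 + q' 1) * (s * r 2 + q' 2)) =
        0 := by
      intro s
      have h := hF' s
      simpa only [hFdef, Pi.add_apply, Pi.smul_apply, smul_eq_mul] using h
    have c4 : r 0 * r 1 * r 2 * r 3 = 0 := by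
      have k0 := key 0; have k1 := key 1; have km1 := key (-1); have k2 := key 2; have km2 := key (-2)
      linear_combination (k2 - 4 * k1 + 6 * k0 - 4 * km1 + km2) / 24 / 4 +
        (r 1 * r 2 * r 3 + r 0 * r 2 * r 3 + r 0 * r 1 * r 3 + r 0 * r 1 * r 2) * hSr / 4
    -- dispatch on the zero coordinate
    have fin : ∀ a b c d : Fin 4, [a, b, c, d].Nodup → (∀ i : Fin 4, i = a ∨ i = b ∨ i = c ∨ i = d) → r a = 0 →
        ∃ x y : Fin 4 → ℂ, (∃ α β : ℂ, x = α • p + β • q) ∧ (∃ α β : ℂ, y = α • p + β • q) ∧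
          ((∃ c d : Fin 4, c ≠ d ∧ x = Pi.single c 1 ∧ y = Pi.single d 1) ∨
           (∃ a b c d : Fin 4, [a, b, c, d].Nodup ∧ x = Pi.single a 1 + Pi.single b 1 ∧
              y = Pi.single c 1 - Pi.single d 1) ∨
           (∃ a b c d : Fin 4, [a, b, c, d].Nodup ∧ x = Pi.single b 1 - Pi.single d 1 ∧
              y = Pi.single c 1 - Pi.single d 1)) := by
      intro a b c d hnd hall hra
      have e4 : ∀ t : Fin 4 → ℂ, t a + t b + t c + t d = t 0 + t 1 + t 2 + t 3 := fun t => sum_four_eq t a b c d hnd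
      have hr0' : ¬(r b = 0 ∧ r c = 0 ∧ r d = 0) := by
        rintro ⟨hb, hc, hd⟩
        exact hr0 (veq hall r 0 (by simpa using hra) (by simpa using hb) (by simpa using hc) (by simpa using hd))
      obtain ⟨x, y, hx, hy, hxy⟩ := planes_case2 F hFdef a b c d hnd hall r q' hra hr0' (by rw [e4]; exact hSr)
        (by rw [e4]; exact hSq') hF'
      exact ⟨x, y, hspan x hx, hspan y hy, by rcases hxy with h | h <;> [exact Or.inl h; exact Or.inr (Or.inl h)]⟩
    rcases mul_eq_zero.1 c4 with h | h
    · rcases mul_eq_zero.1 h with h | h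
      · rcases mul_eq_zero.1 h with h | h
        · exact fin 0 1 2 3 (by decide) (by decide) h
        · exact fin 1 0 2 3 (by decide) (by decide) h
      · exact fin 2 0 1 3 (by decide) (by decide) h
    · exact fin 3 0 1 2 (by decide) (by decide) h

end LaplaceFourLine

end Summit.ValiantsHypothesis.ValiantsHypothesis.Theorems.RigidityForcesSymmetryRankRigidMinimalRepr
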